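import Summits.ABC.IUTFork.LDHGenuinePerImageExplicit
import Summits.ABC.IUTFork.LDHGenuineStepVBound
import HarnessLib

/-!
# The fork at [IUTchIII] Corollary 3.12, L-DH level, READING (P): [IUTchIV] Thm. 1.10 Step (v) for the GENUINE datum
# in the K-level currency (V) of the route's junction — every `d_mod`, no slot-constancy
# (abc-iut cell, crux ThetaPartII = stmt-ABC-19678; RESHAPE-3 child (ii′-P) `stub_hullVolumePerImage`, support S-a-P)

Record-only file (D-0012) of the abc-iut cell (WAVE-3 discharge seat abc-iut-c312-d1, gen 4); TAKES NO SIDE.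
Mochizuki, *Inter-universal Teichmüller theory IV* (RIMS ms Apr. 2020 = PRIMS **57** (2021)), Thm. 1.10 p. 22
(`e*_mod := 2^12·3^3·5·e_mod ≤ d*_mod`), proof Step (iii) pp. 25–26 ((R4), `ι_{v_ℚ}`, `log(𝔰^≤)`), Step (v) pp. 27–29
(`i† := j`, `l*_mod := log(e*_mod·l)`), Step (viii) p. 30; *IUT III* (RIMS ms May 2020) Cor. 3.12 proof Step (x)
p. 181 (reading (P): the log-volume of the hull of ANY ONE (Ind1)×(Ind2)-image).

The exact mirror, for abc-iut-S7's per-(slot-)image reading (P) (`GenuineLogThetaPerImage`, `LDHGenuinePerImage`,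
`LDHGenuinePerImageExplicit`: `HullEstimatePerImageOf`, `hullEstimatePerImageOf_ofInput_explicit` — the Step (v)
constant for EVERY genuine input, NO slot-constancy, since the slot images carry the theta value at the last slot
`i† = j` only), of abc-iut-c312-d1's `LDHGenuineStepVBound` / `LDHGenuineStepVPoint` (reading (U), slot-constant
regime): the constant is put in the K-LEVEL CURRENCY (V) of the junction with the tower arithmetic (abc-iut-S3's
`Cor22.deltaK_le_BIII`):
* `hullEstimatePerImageOf_ofInput_stepV` — `I.HullEstimatePerImageOf ((l+1)/4·{(1+4/l)·dK + (4/l)·sQ +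
  (20/3)·log(2^12·3^3·5·e_mod·l)·sLe})` for any `dK, sQ, sLe` dominating the different sum, `Σ_{p∈T(I)} log p` and
  `#{p ∈ T(I) : p ≤ e*_mod·l}`, from the (R4)-shape input at `e_mod` — EVERY genuine input, every `d_mod`;
* `…_of_iotaForm` — free `L = I.X.l`, (R4) in abc-iut-S1's `ι`-form; `…_of_iotaForm_pi` — `sLe := π(e*_mod·L)`;
* `PointStepV.hullEstimatePerImageOf_stepV_at` — the same at a genuine Θ-volume DATUM `T : Cor22.ThetaVolumeDatumAt P l`
  (every point, every `d_mod`): `T.HullEstimatePerImageOf (…)`, the (V)-input of `Cor22.deltaK_le_BIII` in reading (P),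
  so that `Cor22.HullVolumePerImageAtDatum P l (B_III P l)` follows datum by datum modulo the tower arithmetic S-b;
  `…_stepV_at'` — in the exact hypothesis currency of abc-iut-S3's `ThetaVolumeDatumAt.hullEstimateOf_BIII_of_bounds'`
  (cast spelling of `log(e*_mod·l)`, count `#{p ∈ T(I) : p ≤ e*_mod·l}`).
[cite: Mochizuki2012, IUTchIV Thm. 1.10 p. 22, proof Steps (iii), (v), (viii) p. 25–30] [cite: Mochizuki2012, IUTchIII
Cor. 3.12 proof Step (x) p. 181] [claim: Mochizuki2012, status: disputed] HONEST SCOPE: reading (P) is ONE of the two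
typed readings of "−|log(Θ)|" (VERDICT RISK 7); nothing here asserts [IUTchIII] Cor. 3.12 in either reading or decides
between them; (V) is the computable half only.
-/

noncomputable section

namespace Summit.ABC.IUTFork

namespace DHData

open Finset Literature.IUT.LogVolume Literature.IUT.LogVolume.Thm110Local NumberField IsDedekindDomain

variable {F₀ : Type} [Field F₀] [NumberField F₀] {K : Type} [Field K] [NumberField K] [Algebra F₀ K]
variable (I : ThetaVolumeInput F₀ K)

/-- **(V) in reading (P), every `d_mod`** — [IUTchIV] Thm. 1.10 Steps (v)–(viii) for the genuine datum with
`−|log(Θ)|` read as the hull volume of ONE image: for the (R4)-shape input at `e_mod` and any `dK, sQ, sLe` dominating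
the different sum, `Σ_{p∈T(I)} log p`, `#{p ∈ T(I) : p ≤ e*_mod·l}`:
`I.HullEstimatePerImageOf ((l+1)/4·{(1+4/l)·dK + (4/l)·sQ + (20/3)·log(2^12·3^3·5·e_mod·l)·sLe})` — NO slot-constancy
hypothesis (abc-iut-S7's `hullEstimatePerImageOf_ofInput_explicit` with `N := e*_mod·l`, `l* := l*_mod`).
[cite: Mochizuki2012, IUTchIV Thm. 1.10 proof Steps (v)–(viii) p. 27–30] [claim: Mochizuki2012, status: disputed] -/
theorem hullEstimatePerImageOf_ofInput_stepV (emod : ℕ) (hemod : 1 ≤ emod) {dK sQ sLe : ℝ}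
    (hdK : (∑ p ∈ I.supportPrimes, if hp : p.Prime then haveI : Fact p.Prime := ⟨hp⟩
            (∑ v : placesOver F₀ p, (localDegree F₀ v.1 : ℝ) *
              differentOrd p ((I.σ.localFieldFamily p hp).k v)) / Module.finrank ℚ F₀ * Real.log p else 0) ≤ dK)
    (hsQ : ∑ p ∈ I.supportPrimes, Real.log p ≤ sQ)
    (hsLe : ((I.supportPrimes.filter (· ≤ 2 ^ 12 * 3 ^ 3 * 5 * emod * I.X.l)).card : ℝ) ≤ sLe)
    (hR4 : ∀ (p : ℕ) [hp : Fact p.Prime], p ∈ I.supportPrimes → ∀ v : placesOver F₀ p,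
      p - 2 < absRamificationIdx p ((I.σ.localFieldFamily p hp.out).k v) →
      p ≤ 2 ^ 12 * 3 ^ 3 * 5 * emod * I.X.l ∧
        3 + Real.log (absRamificationIdx p ((I.σ.localFieldFamily p hp.out).k v)) ≤
          4 * Real.log ((2 : ℝ) ^ 12 * 3 ^ 3 * 5 * emod * I.X.l)) :
    I.HullEstimatePerImageOf
      (((I.X.l : ℝ) + 1) / 4 * ((1 + 4 / (I.X.l : ℝ)) * dK + 4 / (I.X.l : ℝ) * sQ
        + 20 / 3 * Real.log ((2 : ℝ) ^ 12 * 3 ^ 3 * 5 * emod * I.X.l) * sLe)) := by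
  have hl1 : 1 ≤ I.X.l := le_trans (by norm_num) I.X.five_le_l
  have hlmod := lstarMod_nonneg hemod hl1
  have h := hullEstimatePerImageOf_ofInput_explicit I (2 ^ 12 * 3 ^ 3 * 5 * emod * I.X.l) hlmod hR4
  refine I.hullEstimatePerImageOf_mono h ?_
  have hl : (0 : ℝ) < I.X.l := by exact_mod_cast (lt_of_lt_of_le (by norm_num) hl1)
  have hc0 : (0 : ℝ) ≤ ((I.X.l : ℝ) + 1) / 4 := by positivity
  have hc1 : (0 : ℝ) ≤ 1 + 4 / (I.X.l : ℝ) := by positivity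
  have hc2 : (0 : ℝ) ≤ 4 / (I.X.l : ℝ) := by positivity
  have hc3 : (0 : ℝ) ≤ 20 / 3 * Real.log ((2 : ℝ) ^ 12 * 3 ^ 3 * 5 * emod * I.X.l) := by positivity
  refine mul_le_mul_of_nonneg_left ?_ hc0
  have e3 : 20 / 3 * Real.log ((2 : ℝ) ^ 12 * 3 ^ 3 * 5 * emod * I.X.l) *
      ((I.supportPrimes.filter (· ≤ 2 ^ 12 * 3 ^ 3 * 5 * emod * I.X.l)).card : ℝ) ≤
      20 / 3 * Real.log ((2 : ℝ) ^ 12 * 3 ^ 3 * 5 * emod * I.X.l) * sLe := mul_le_mul_of_nonneg_left hsLe hc3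
  have e1 := mul_le_mul_of_nonneg_left hdK hc1
  have e2 := mul_le_mul_of_nonneg_left hsQ hc2
  linarith

/-- **(V) in reading (P) with the prime as a free natural number `L = l` and (R4) in abc-iut-S1's `ι`-form**
(`PlaceSection.R4_localFieldFamily` / `Cor22.R4_divisionTower`), free `dK, sQ, sLe` — the hypotheses of abc-iut-S3's
`Cor22.deltaK_le_BIII` verbatim. [cite: Mochizuki2012, IUTchIV Thm. 1.10 proof Steps (iii), (v)–(viii) p. 25–30]
[claim: Mochizuki2012, status: disputed] -/
theorem hullEstimatePerImageOf_ofInput_stepV_of_iotaForm {L : ℕ} (hL : I.X.l = L) (emod : ℕ) (hemod : 1 ≤ emod)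
    {dK sQ sLe : ℝ}
    (hdK : (∑ p ∈ I.supportPrimes, if hp : p.Prime then haveI : Fact p.Prime := ⟨hp⟩
            (∑ v : placesOver F₀ p, (localDegree F₀ v.1 : ℝ) *
              differentOrd p ((I.σ.localFieldFamily p hp).k v)) / Module.finrank ℚ F₀ * Real.log p else 0) ≤ dK)
    (hsQ : ∑ p ∈ I.supportPrimes, Real.log p ≤ sQ)
    (hsLe : ((I.supportPrimes.filter (· ≤ 2 ^ 12 * 3 ^ 3 * 5 * emod * L)).card : ℝ) ≤ sLe)
    (hR4 : ∀ (p : ℕ) [hp : Fact p.Prime], p ∈ I.supportPrimes → ∀ v : placesOver F₀ p,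
      p - 2 < absRamificationIdx p ((I.σ.localFieldFamily p hp.out).k v) →
      3 + Real.log (absRamificationIdx p ((I.σ.localFieldFamily p hp.out).k v)) ≤
        4 * (if p ≤ 2 ^ 12 * 3 ^ 3 * 5 * emod * L then (1 : ℝ) else 0) *
          Real.log (((2 ^ 12 * 3 ^ 3 * 5 * emod : ℕ) : ℝ) * L)) :
    I.HullEstimatePerImageOf
      (((L : ℝ) + 1) / 4 * ((1 + 4 / (L : ℝ)) * dK + 4 / (L : ℝ) * sQ
        + 20 / 3 * Real.log ((2 : ℝ) ^ 12 * 3 ^ 3 * 5 * emod * L) * sLe)) := by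
  subst hL
  exact hullEstimatePerImageOf_ofInput_stepV I emod hemod hdK hsQ hsLe
    (fun p hp hpT v hv => r4_of_iotaForm (hR4 p hpT v) hv)

/-- **The same with `sQ := Σ_{p∈T(I)} log p` and `sLe := π(e*_mod·L)`** (print's values; `card_filter_le_primeCounting`).
[cite: Mochizuki2012, IUTchIV Thm. 1.10 proof Steps (iii), (v)–(viii) p. 25–30] [claim: Mochizuki2012, status: disputed] -/
theorem hullEstimatePerImageOf_ofInput_stepV_of_iotaForm_pi {L : ℕ} (hL : I.X.l = L) (emod : ℕ) (hemod : 1 ≤ emod)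
    {dK : ℝ}
    (hdK : (∑ p ∈ I.supportPrimes, if hp : p.Prime then haveI : Fact p.Prime := ⟨hp⟩
            (∑ v : placesOver F₀ p, (localDegree F₀ v.1 : ℝ) *
              differentOrd p ((I.σ.localFieldFamily p hp).k v)) / Module.finrank ℚ F₀ * Real.log p else 0) ≤ dK)
    (hR4 : ∀ (p : ℕ) [hp : Fact p.Prime], p ∈ I.supportPrimes → ∀ v : placesOver F₀ p,
      p - 2 < absRamificationIdx p ((I.σ.localFieldFamily p hp.out).k v) →
      3 + Real.log (absRamificationIdx p ((I.σ.localFieldFamily p hp.out).k v)) ≤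
        4 * (if p ≤ 2 ^ 12 * 3 ^ 3 * 5 * emod * L then (1 : ℝ) else 0) *
          Real.log (((2 ^ 12 * 3 ^ 3 * 5 * emod : ℕ) : ℝ) * L)) :
    I.HullEstimatePerImageOf
      (((L : ℝ) + 1) / 4 * ((1 + 4 / (L : ℝ)) * dK + 4 / (L : ℝ) * (∑ p ∈ I.supportPrimes, Real.log p)
        + 20 / 3 * Real.log ((2 : ℝ) ^ 12 * 3 ^ 3 * 5 * emod * L)
          * (Nat.primeCounting (2 ^ 12 * 3 ^ 3 * 5 * emod * L) : ℝ))) :=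
  hullEstimatePerImageOf_ofInput_stepV_of_iotaForm I hL emod hemod hdK le_rfl
    (card_filter_le_of_primeCounting_le I le_rfl) hR4

end DHData

/-! ## At a genuine Θ-volume datum of a point — every point, every `d_mod` -/

namespace PointStepV

open Literature.IUT.LogVolume Literature.IUT.HodgeTheaters NumberField IsDedekindDomain
open Literature.NumberTheory.DiophantineGeometry.GenEll

variable {P : NFPoint} {l : ℕ}

/-- **(V) in reading (P) for EVERY genuine Θ-volume datum at EVERY point** (no degree or slot-constancy hypothesis),
from the (R4)-shape tameness input at `e_mod` (abc-iut-S1's `ι`-form) and a bound `dK` of the different sum: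
`T.HullEstimatePerImageOf ((l+1)/4·{(1+4/l)·dK + (4/l)·Σ_{p∈T(I)} log p + (20/3)·log(2^12·3^3·5·e_mod·l)·π(2^12·3^3·5·e_mod·l)})`
— the (V)-input of abc-iut-S3's `Cor22.deltaK_le_BIII` in reading (P). [cite: Mochizuki2012, IUTchIV Thm. 1.10 proof Steps (v)–(viii) p. 27–30]
[cite: Mochizuki2012, IUTchIII Cor. 3.12 proof Step (x) p. 181] [claim: Mochizuki2012, status: disputed] -/
theorem hullEstimatePerImageOf_stepV_at (T : Cor22.ThetaVolumeDatumAt P l) (emod : ℕ) (hemod : 1 ≤ emod) {dK : ℝ}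
    (hdK : letI := T.instFieldF; letI := T.instNumberFieldF; letI := T.instAlgebraF; letI := T.instIsElliptic
      letI := T.instFieldK; letI := T.instNumberFieldK; letI := T.instAlgebraK
      (∑ p ∈ T.I.supportPrimes, if hp : p.Prime then haveI : Fact p.Prime := ⟨hp⟩
        (∑ v : placesOver (fieldOfModuli T.E) p, (localDegree (fieldOfModuli T.E) v.1 : ℝ) *
          differentOrd p ((T.I.σ.localFieldFamily p hp).k v)) / Module.finrank ℚ (fieldOfModuli T.E) * Real.log p
        else 0) ≤ dK)
    (hR4 : letI := T.instFieldF; letI := T.instNumberFieldF; letI := T.instAlgebraF; letI := T.instIsElliptic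
      letI := T.instFieldK; letI := T.instNumberFieldK; letI := T.instAlgebraK
      ∀ (p : ℕ) [hp : Fact p.Prime], p ∈ T.I.supportPrimes → ∀ v : placesOver (fieldOfModuli T.E) p,
        p - 2 < absRamificationIdx p ((T.I.σ.localFieldFamily p hp.out).k v) →
        3 + Real.log (absRamificationIdx p ((T.I.σ.localFieldFamily p hp.out).k v)) ≤
          4 * (if p ≤ 2 ^ 12 * 3 ^ 3 * 5 * emod * l then (1 : ℝ) else 0) *
            Real.log (((2 ^ 12 * 3 ^ 3 * 5 * emod : ℕ) : ℝ) * l)) :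
    T.HullEstimatePerImageOf
      (((l : ℝ) + 1) / 4 * ((1 + 4 / (l : ℝ)) * dK
        + 4 / (l : ℝ) *
          (letI := T.instFieldF; letI := T.instNumberFieldF; letI := T.instAlgebraF; letI := T.instIsElliptic
           letI := T.instFieldK; letI := T.instNumberFieldK; letI := T.instAlgebraK
           ∑ p ∈ T.I.supportPrimes, Real.log (p : ℝ))
        + 20 / 3 * Real.log ((2 : ℝ) ^ 12 * 3 ^ 3 * 5 * emod * l)
          * (Nat.primeCounting (2 ^ 12 * 3 ^ 3 * 5 * emod * l) : ℝ))) := by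
  letI := T.instFieldF; letI := T.instNumberFieldF; letI := T.instAlgebraF; letI := T.instIsElliptic
  letI := T.instFieldK; letI := T.instNumberFieldK; letI := T.instAlgebraK
  exact DHData.hullEstimatePerImageOf_ofInput_stepV_of_iotaForm_pi T.I T.l_eq emod hemod hdK hR4

/-- `log(e*_mod·L)` with the natural-number product cast (abc-iut-S1's / abc-iut-S3's spelling) equals the real
spelling. [cite: Mochizuki2012, IUTchIV Thm. 1.10 proof Step (v) p. 28] -/
theorem log_estar_mul_cast (emod L : ℕ) :
    Real.log (((2 ^ 12 * 3 ^ 3 * 5 * emod : ℕ) : ℝ) * L) = Real.log ((2 : ℝ) ^ 12 * 3 ^ 3 * 5 * emod * L) := by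
  push_cast; ring_nf

/-- **The same in the EXACT hypothesis currency of abc-iut-S3's `Cor22.ThetaVolumeDatumAt.hullEstimateOf_BIII_of_bounds'`**
(cast spelling of `log(e*_mod·l)`, the count as `#{p ∈ T(I) : p ≤ e*_mod·l}`): with `A := dK`, `B := Σ_{p∈T(I)} log p`,
`s := T(I)` the (P)-twin of that lemma turns it into `T.HullEstimatePerImageOf (B_III P l)`.
[cite: Mochizuki2012, IUTchIV Thm. 1.10 proof Steps (iii), (v)–(viii) p. 25–30] [claim: Mochizuki2012, status: disputed] -/
theorem hullEstimatePerImageOf_stepV_at' (T : Cor22.ThetaVolumeDatumAt P l) (emod : ℕ) (hemod : 1 ≤ emod) {dK : ℝ}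
    (hdK : letI := T.instFieldF; letI := T.instNumberFieldF; letI := T.instAlgebraF; letI := T.instIsElliptic
      letI := T.instFieldK; letI := T.instNumberFieldK; letI := T.instAlgebraK
      (∑ p ∈ T.I.supportPrimes, if hp : p.Prime then haveI : Fact p.Prime := ⟨hp⟩
        (∑ v : placesOver (fieldOfModuli T.E) p, (localDegree (fieldOfModuli T.E) v.1 : ℝ) *
          differentOrd p ((T.I.σ.localFieldFamily p hp).k v)) / Module.finrank ℚ (fieldOfModuli T.E) * Real.log p
        else 0) ≤ dK)
    (hR4 : letI := T.instFieldF; letI := T.instNumberFieldF; letI := T.instAlgebraF; letI := T.instIsElliptic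
      letI := T.instFieldK; letI := T.instNumberFieldK; letI := T.instAlgebraK
      ∀ (p : ℕ) [hp : Fact p.Prime], p ∈ T.I.supportPrimes → ∀ v : placesOver (fieldOfModuli T.E) p,
        p - 2 < absRamificationIdx p ((T.I.σ.localFieldFamily p hp.out).k v) →
        3 + Real.log (absRamificationIdx p ((T.I.σ.localFieldFamily p hp.out).k v)) ≤
          4 * (if p ≤ 2 ^ 12 * 3 ^ 3 * 5 * emod * l then (1 : ℝ) else 0) *
            Real.log (((2 ^ 12 * 3 ^ 3 * 5 * emod : ℕ) : ℝ) * l)) :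
    T.HullEstimatePerImageOf
      (((l : ℝ) + 1) / 4 * ((1 + 4 / (l : ℝ)) * dK
        + 4 / (l : ℝ) *
          (letI := T.instFieldF; letI := T.instNumberFieldF; letI := T.instAlgebraF; letI := T.instIsElliptic
           letI := T.instFieldK; letI := T.instNumberFieldK; letI := T.instAlgebraK
           ∑ p ∈ T.I.supportPrimes, Real.log (p : ℝ))
        + 20 / 3 * Real.log (((2 ^ 12 * 3 ^ 3 * 5 * emod : ℕ) : ℝ) * l)
          * (letI := T.instFieldF; letI := T.instNumberFieldF; letI := T.instAlgebraF; letI := T.instIsElliptic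
             letI := T.instFieldK; letI := T.instNumberFieldK; letI := T.instAlgebraK
             ((T.I.supportPrimes.filter (· ≤ 2 ^ 12 * 3 ^ 3 * 5 * emod * l)).card : ℝ)))) := by
  letI := T.instFieldF; letI := T.instNumberFieldF; letI := T.instAlgebraF; letI := T.instIsElliptic
  letI := T.instFieldK; letI := T.instNumberFieldK; letI := T.instAlgebraK
  rw [log_estar_mul_cast]
  exact DHData.hullEstimatePerImageOf_ofInput_stepV_of_iotaForm T.I T.l_eq emod hemod hdK le_rfl le_rfl hR4

end PointStepV

end Summit.ABC.IUTFork

end
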